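import Summits.NavierStokesRegularity.NavierStokesRegularity.Theorems.AdaptedFrequencyFrequencyRigidityOfTypeIAncientLiouville
import Literature.Analysis.FluidPDE.KNSSTypeIRateLiouvilleMild
import HarnessLib

/-!
# Crux `FrequencyRigidity` (stmt-NavierStokesRegularity-2955), line `two-ended-pinning`:
# (L) ⇒ (L′) — the KNSS Liouville conjecture implies the Type-I ancient Liouville statement

Helper file (lands `--supports stmt-NavierStokesRegularity-2955`, registered sub-goal
`typeIAncientLiouville_of_liouvilleConjectureNS`; theorems only).  It makes the FIRST arrow of the crux's
sandwich a tree theorem, so that the classification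

    (L) = stmt-10661/0057  ⇒  (L′) = stmt-4050  ⇒  FrequencyRigidity  ⇔  S3L  ⇒  ∀ α, RSSLiouvilleBounded α
        (this file)            (p121984)           (p118721)          (p119711)

is checked end to end, and CERTIFIES for the planners of routes ExtremalTypeIConstant, SymmetryModuliCount and
TypeILiouville that item 4050 (`Theses.ExtremalTypeIConstant.TypeIAncientLiouville`) is weaker than item
10661/0057 (`LiouvilleConjectureNS`).  Elementary: a field of (L′)'s class (jointly smooth, divergence free,
KNSS-mild in the Oseen gauge, time-Type-I), translated into the past by `δ > 0`, is a bounded continuous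
Oseen-mild ancient field with weakly divergence-free slices, hence a bounded ancient mild solution of the
duality-form class (`isBoundedAncientMildSolution_of_oseen`, Lemarié-Rieusset 2016 Thm 6.1); (L) makes its slices
a.e. — by continuity everywhere — constant; KNSS Remark 6.1 (`KNSS2009_remark61`) makes the constant
time-independent; the Type-I decay at `t → −∞` makes it zero.  CONDITIONAL on (L) through an explicit hypothesis;
nothing is asserted.

## References

* G. Koch, N. Nadirashvili, G. Seregin, V. Šverák, Acta Math. 203 (2009) 83–105 = arXiv:0709.3599, §1 p. 3
  (conjecture (L)), Remark 6.1, §6. [KochNadirashviliSereginSverak2009]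
* P. G. Lemarié-Rieusset, *The Navier–Stokes problem in the 21st century* (2016), Thm 6.1. [LemarieRieusset2016]
-/

set_option linter.dupNamespace false

noncomputable section

namespace Summit.NavierStokesRegularity.NavierStokesRegularity.Theorems.FrequencyRigidity.TwoEndedPinning

open Literature.Analysis Literature.Analysis.FluidPDE MeasureTheory Set Filter Topology Function
open scoped RealInnerProductSpace

/-- **(L) ⇒ (L′)** (`LiouvilleConjectureNS → TypeIAncientLiouville`; item stmt-NavierStokesRegularity-10661/0057 ⇒
item stmt-NavierStokesRegularity-4050).  CONDITIONAL on (L) (explicit hypothesis); nothing is asserted.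
[cite: KochNadirashviliSereginSverak2009, §1 p. 3, Remark 6.1 and §6 (arXiv:0709.3599)] -/
theorem typeIAncientLiouville_of_liouvilleConjectureNS :
    Summit.NavierStokesRegularity.NavierStokesRegularity.LiouvilleConjectureNS →
      Summit.NavierStokesRegularity.NavierStokesRegularity.Theses.ExtremalTypeIConstant.TypeIAncientLiouville := by
  intro hLiou
  rintro C u ⟨hsm, hdiv, hmildK, hTI⟩
  -- the Oseen form of the mild identity
  have hclass : IsTypeIAncientMild C u := isTypeIAncientMild_iff.2 ⟨hsm, hdiv, hmildK, hTI⟩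
  have hmild : ∀ s t : ℝ, s < t → t < 0 → ∀ x,
      u t x = UnboundedOperators.heatExtension (u s) (t - s) x - oseenDuhamel 1 s u u t x := by
    intro s t hst ht x
    rw [← heatFlow_of_pos _ (sub_pos.2 hst)]
    exact hclass.2.2.1 s t hst ht x
  have hcontu : ContinuousOn (uncurry u) (Iio 0 ×ˢ univ) := hsm.continuousOn
  have hC0 : 0 ≤ C := by
    have h1 := hTI (-1) (by norm_num) 0
    have h2 : (0 : ℝ) ≤ C / Real.sqrt (-(-1:ℝ)) := (norm_nonneg _).trans h1
    simpa using h2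
  -- Step 1: every slice is constant ((L) on the past translates)
  have hconst : ∀ τ < 0, ∃ b : EuclideanSpace ℝ (Fin 3), ∀ y, u τ y = b := by
    intro τ hτ
    set δ : ℝ := -τ / 2 with hδ_def
    have hδ : 0 < δ := by rw [hδ_def]; linarith
    set W : ℝ → EuclideanSpace ℝ (Fin 3) → EuclideanSpace ℝ (Fin 3) := fun s => u (s - δ) with hW_def
    have hWcont : ContinuousOn (uncurry W) (Iio 0 ×ˢ univ) := by
      have hψ : ContinuousOn (fun q : ℝ × EuclideanSpace ℝ (Fin 3) => (q.1 - δ, q.2)) (Iio 0 ×ˢ univ) :=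
        (continuousOn_fst.sub continuousOn_const).prodMk continuousOn_snd
      have hmaps : MapsTo (fun q : ℝ × EuclideanSpace ℝ (Fin 3) => (q.1 - δ, q.2))
          (Iio 0 ×ˢ univ) (Iio 0 ×ˢ univ) := fun q hq =>
        ⟨show q.1 - δ < 0 by have := hq.1; rw [mem_Iio] at this; linarith, mem_univ _⟩
      exact (hcontu.comp hψ hmaps).congr fun q _ => rfl
    have hWbdd : ∃ K : ℝ, ∀ t < 0, ∀ x, ‖W t x‖ ≤ K := by
      refine ⟨C / Real.sqrt δ, fun t ht x => ?_⟩
      have htδ : t - δ < 0 := by linarith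
      refine (hTI (t - δ) htδ x).trans ?_
      exact div_le_div_of_nonneg_left hC0 (Real.sqrt_pos.2 hδ) (Real.sqrt_le_sqrt (by linarith))
    have hsm' : IsSmoothSpaceTimeOn (Iio 0) u := hsm
    have hWdiv : ∀ t < 0, IsWeaklyDivFree (W t) := fun t ht =>
      VectorCalculus.IsDivFree.isWeaklyDivFree_holds (hdiv (t - δ) (by linarith))
        ((hsm'.contDiff_slice (show t - δ ∈ Iio (0:ℝ) by rw [mem_Iio]; linarith)).of_le (by norm_cast))
    have hWmild : ∀ s t : ℝ, s < t → t < 0 → ∀ x,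
        W t x = UnboundedOperators.heatExtension (W s) (1 * (t - s)) x - oseenDuhamel 1 s W W t x := by
      intro s t hst ht x
      show u (t - δ) x = UnboundedOperators.heatExtension (u (s - δ)) (1 * (t - s)) x -
        oseenDuhamel 1 s (fun τ => u (τ - δ)) (fun τ => u (τ - δ)) t x
      rw [one_mul, oseenDuhamel_comp_sub_right, hmild (s - δ) (t - δ) (by linarith) (by linarith) x,
        show t - δ - (s - δ) = t - s by ring]
    have hBAMS : IsBoundedAncientMildSolution 1 W :=
      isBoundedAncientMildSolution_of_oseen one_pos hWcont hWbdd hWdiv hWmild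
    have hmeas : ∀ s < 0, AEStronglyMeasurable (W s) volume := fun s hs =>
      (hWcont.comp_continuous (continuous_const.prodMk continuous_id)
        fun x => ⟨hs, mem_univ _⟩).aestronglyMeasurable
    have hτ2 : τ + δ < 0 := by rw [hδ_def]; linarith
    obtain ⟨b, hb⟩ := hLiou W hBAMS hmeas (τ + δ) hτ2
    have hcW : Continuous (W (τ + δ)) :=
      hWcont.comp_continuous (continuous_const.prodMk continuous_id) fun x => ⟨hτ2, mem_univ _⟩
    have heq : W (τ + δ) = fun _ => b := (Continuous.ae_eq_iff_eq volume hcW continuous_const).1 hb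
    refine ⟨b, fun y => ?_⟩
    have h1 := congrFun heq y
    simp only [hW_def] at h1
    rwa [show τ + δ - δ = τ by ring] at h1
  -- Step 2: the constant does not depend on time (KNSS Remark 6.1)
  choose! b hb using hconst
  have hb_eq : ∀ s t : ℝ, s < 0 → t < 0 → b s = b t :=
    KNSS2009_remark61 one_pos (fun t ht x => hb t ht x)
      (fun s t hst ht => Eventually.of_forall fun x => by rw [one_mul]; exact hmild s t hst ht x)
  -- Step 3: Type-I decay at `t → −∞` forces the constant to vanish
  intro t ht x
  rw [hb t ht x]
  refine eq_zero_of_forall_lt_sqrt_neg_mul_norm_le (t := t) (C := C) (fun s hs => ?_) ht.le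
  have hs0 : s < 0 := hs.trans ht
  have h1 : ‖u s 0‖ ≤ C / Real.sqrt (-s) := hTI s hs0 0
  rw [hb s hs0 0, hb_eq s t hs0 ht] at h1
  have hsq : 0 < Real.sqrt (-s) := Real.sqrt_pos.2 (by linarith)
  rw [le_div_iff₀ hsq] at h1
  linarith [h1]

/-- Hence the full chain is checked: **(L) ⇒ FrequencyRigidity THROUGH (L′)** (consistent with the direct
bridge `frequencyRigidity_of_liouvilleConjectureNS`, p107437). [cite: KochNadirashviliSereginSverak2009, §1 p. 3 (arXiv:0709.3599)] -/
theorem frequencyRigidity_of_liouvilleConjectureNS_via_typeIAncientLiouville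
    (hLiou : Summit.NavierStokesRegularity.NavierStokesRegularity.LiouvilleConjectureNS) :
    Summit.NavierStokesRegularity.NavierStokesRegularity.Theses.AdaptedFrequency.FrequencyRigidity :=
  frequencyRigidity_of_typeIAncientLiouville (typeIAncientLiouville_of_liouvilleConjectureNS hLiou)

end Summit.NavierStokesRegularity.NavierStokesRegularity.Theorems.FrequencyRigidity.TwoEndedPinning

end
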